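import Summits.QuantumFields.YangMills.Theorems.BalabanUVNodesPortS1Sect5SymmetryOfRows
import Summits.QuantumFields.YangMills.Theorems.BalabanUVNodesN09GaugeFixingTermContinuousOnAdmissible

/-!
# NODE O port, row PT-A-2 S5-0 (ii) ∕ S5-A AT THE RE-CENTRED RECORD — the COORDINATE-PERMUTATION third of [Balaban1987RG1] (2.17) p. 269 for `A_k` and
# `𝓝_{k+1}` over `TβOfRecord₁₃` and `chiβOfRecord₁₃Ax`, ON THE SMALL-FIELD DOMAINS, and the full symmetry triple (5.6)–(5.8) of the record's limiting kernel
# `recordPlimAx` FROM N09-SHAPE ROWS ONLY (the π-row that `…Sect5SymmetryOfRows` left displayed)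

CITATION HEADER.  [I] = [Balaban1987RG1]: (2.17)–(2.18) p. 269, p. 263, (0.11) p. 253, (0.13) p. 254, (0.19) p. 255, (1.6) p. 261, (1.2) p. 260, (1.21)–(1.22) p. 264,
(5.2)–(5.8) pp. 292–293; [B11] = [Balaban1985Variational] Thm 1 p. 279.  Porter PT-A-2 (`ymgap-nodeO-port-PTA-2`), `--supports stmt-QuantumFields-27930 --as helper`.
WHY A SEPARATE FILE.  The permutation rows of the cut-off `χ^{Ax}` (FILE E2 `chiFixed29Ax_permute_of_adm`) and of the gauge-fixing term (`B12GaugeFixInvariance269.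
gaugeFixFn_permute_of_adm`) carry a FEDERBUSH-ADMISSIBILITY clause (the group mean (0.10) of the staircase family (0.11) is the printed, permutation-symmetric average only
on admissible families); on `a`-small fields that clause is dag-n09-w1's theorem `adm_stairHol_of_plaqSmall` under the numeric guard `((d·L)²∕4)·a < δ_N`.  So the π-rows
cost, beyond the τ∕c_ρ rows of FILE `…Sect5EuclOnAx`, ONE numeric row on `ν.ε₀` and ONE nesting row «`V^{(j)}(W) ∈ domAlt_j` for `W ∈ domAlt_{j+1}`» ((2.3) p. 265's critical
configuration of a small field is small — (2.9)–(2.10) p. 266's regime, N09 shape, asserted nowhere).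
DISPLAYED ROWS (N09 shapes ∕ numerics, asserted nowhere): [B11] Thm 1 on the small-field domains at radius `ν.εreg`; (F7a) «`domAlt_{j+1} ⊆ regSet_j(ρ_j)`»; (F7a-supp); (I19);
the NESTING rows «`Ū^k U_{k+1}(W) ∈ domAlt_k`» (radius `ε`) and «`V^{(j)}(W) ∈ domAlt_j`» (radius `ν.εreg`); `0 ≤ ν.ε₀` and `((d·L)²∕4)·ν.ε₀ < δ_N`.
WHAT IS PROVED (0 sorry, 0 def).
* §1 `permute_mem_domAltOfRecord_iff`; `adm_stairHol_of_mem_domAlt` (every staircase family over `B(y)` of a field in `domAlt_j` is admissible, numerics displayed);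
  `gfOfRecord_permute_of_mem_domAlt` (`G(πU) = G(U)` on `domAlt_j`); `chiβOfRecord₁₃Ax_permute_of_mem_domAlt` (`χ^{Ax}_j(πU) = χ^{Ax}_j(U)` over the fibres of `domAlt_{j+1}`).
* §2 `invOn_effActionHT_recordAx_permute`: `A_k(πU) = A_k(U)` on `domAlt_k` (`A_0` everywhere), all `k ≤ n ≤ K`.
* §3 ★ `mergedTermT_permute_on_recordAx`: `𝓝_{k+1}(πW) = 𝓝_{k+1}(W)` for `W ∈ domAlt_{k+1}` — the `hN` π-clause of `…Sect5ChartSymmetry.recordPlimAx_symmetries_of_local` REDUCED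
  to the displayed rows.
* §4 ★★ `recordPlimAx_symmetries_of_rows`: `IndexSymmetric ∧ PermCovariant ∧ ReflCovariant` for `recordPlimAx F a₀ ε₂₉ k v` ((5.6), (5.7), (5.8)₂ at the record) from rows only;
  ★ `betaOfRecord₁₃Ax_eq_secondMoment_of_rows` — (1.22) «for μ, ν arbitrary, μ ≠ ν» at the record on the β-box, from rows only.
HONEST FRAMING.  Bookkeeping over displayed rows; nothing of Bałaban's estimates asserted, ported or discharged; 27930 signed-open (⁸-Ax-LR4), no claim held; finite 𝕋⁴ at fixed ε
— NOT continuum∕OS∕Clay; the Yang–Mills mass gap is NOT proved by any of this.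
-/

noncomputable section

open scoped Matrix.Norms.L2Operator Topology

namespace Summit.QuantumFields.YangMills.Theorems.BalabanUVNodesPortS1

open Filter MeasureTheory
open Literature.MathematicalPhysics.QuantumFieldTheory.Balaban1983to89
open Literature.MathematicalPhysics.QuantumFieldTheory.Balaban1983to89.Node00
open T4Continuum (T4Family)
open B12Eq019ActionBody (integrand integrand_apply wilsonTerm_apply)
open GaugeField (gaugeAct)
open B12ContinuousTransportInvarianceOn (isOpen_domAltOfRecord)
open BlockAveragingTwoLevel (stairHol offsetOf)
open FederbushMean (federbushSU deltaFed)
open Summit.QuantumFields.YangMills.BalabanUVNodes.N09GaugeFixingTermContinuousOnAdmissible (adm_stairHol_of_plaqSmall)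

variable {F : T4Family} {N : ℕ} [NeZero N]

/-! ## §1 The permutation rows of the domain, the gauge-fixing term and the re-centred cut-off -/

section Rows

variable (θ₀ : Stage13Params F N) (K : ℕ) (g : ℕ → ℝ)

/-- The record's small-field domain is permutation-stable (`iff`). [cite: Balaban1987RG1, p.259, (2.17) p.269 (bookkeeping)] -/
theorem permute_mem_domAltOfRecord_iff (ν : Stage7Numerics) (k : ℕ) (π : Equiv.Perm (Fin (F.P K).d)) (V : GaugeField (F.P K) k (SU N)) :
    V.permute π ∈ domAltOfRecord F N ν K k ↔ V ∈ domAltOfRecord F N ν K k := by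
  rw [mem_domAltOfRecord_iff, mem_domAltOfRecord_iff]
  exact B12RegularClassInvariance263.plaqSmall_permute_iff ν.ε₀ π V

/-- **ON THE SMALL-FIELD DOMAIN EVERY STAIRCASE FAMILY OVER `B(y)` IS FEDERBUSH-ADMISSIBLE**, under the numeric guard `0 ≤ ν.ε₀`, `((d·L)²∕4)·ν.ε₀ < δ_N` (dag-n09-w1's
`adm_stairHol_of_plaqSmall` read on `domAltOfRecord`). [cite: Balaban1987RG1, (0.5) and (0.11) p.253, p.259] -/
theorem adm_stairHol_of_mem_domAlt (ν : Stage7Numerics) {k : ℕ} (hk : k + 1 ≤ (F.P K).m + (F.P K).K) (hε : 0 ≤ ν.ε₀)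
    (hnum : ((((F.P K).d * (F.P K).L : ℕ) : ℝ)) ^ 2 / 4 * ν.ε₀ < deltaFed (Fin N)) {U : GaugeField (F.P K) k (SU N)}
    (hU : U ∈ domAltOfRecord F N ν K k) (y : Site (F.P K) (k + 1)) {x : Site (F.P K) k} (hx : x ∈ block y) :
    (federbushSU (n := Fin N)).Adm (stairHol U y (offsetOf y x)) :=
  adm_stairHol_of_plaqSmall hk hε ((mem_domAltOfRecord_iff F N ν K k U).1 hU) hnum y hx

/-- **`G(πU) = G(U)` ON THE SMALL-FIELD DOMAIN** — the gauge-fixing term of record is permutation invariant on `domAlt_k` (the admissibility clause of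
`B12GaugeFixInvariance269.gaugeFixFn_permute_of_adm` discharged by `adm_stairHol_of_mem_domAlt`). [cite: Balaban1987RG1, (2.17) p.269, (0.11) p.253] -/
theorem gfOfRecord_permute_of_mem_domAlt (ν : Stage7Numerics) {k : ℕ} (hk : k + 1 ≤ (F.P K).m + (F.P K).K) (hε : 0 ≤ ν.ε₀)
    (hnum : ((((F.P K).d * (F.P K).L : ℕ) : ℝ)) ^ 2 / 4 * ν.ε₀ < deltaFed (Fin N)) (π : Equiv.Perm (Fin (F.P K).d))
    (U : GaugeField (F.P K) k (SU N)) (hU : U ∈ domAltOfRecord F N ν K k) :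
    gfOfRecord F N K k (U.permute π) = gfOfRecord F N K k U :=
  B12GaugeFixInvariance269.gaugeFixFn_permute_of_adm federbushSU π U fun y _ hx =>
    adm_stairHol_of_mem_domAlt K ν hk hε hnum hU y (Finset.mem_of_mem_erase hx)

/-- **`χ^{Ax}_j(πU) = χ^{Ax}_j(U)`** for every `U` whose average lies in the small-field domain of level `j+1` (permutation-stable), given [B11] Thm 1 on that domain at the
cut-off's radius, the NESTING row «`V^{(j)}(W) ∈ domAlt_j` for `W ∈ domAlt_{j+1}`» and the numeric guard (FILE E2's row fed at `Ū` and `πŪ`, its admissibility clause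
discharged on the domain). [cite: Balaban1987RG1, (2.17) p.269, (2.9) p.266, (2.3) p.265, (0.11) p.253; Balaban1985Variational, Thm 1 p.279] -/
theorem chiβOfRecord₁₃Ax_permute_of_mem_domAlt {j : ℕ} (hj : j + 1 ≤ (F.P K).m + (F.P K).K) (hε : 0 ≤ θ₀.ν.ε₀)
    (hnum : ((((F.P K).d * (F.P K).L : ℕ) : ℝ)) ^ 2 / 4 * θ₀.ν.ε₀ < deltaFed (Fin N))
    (h11 : ∀ W ∈ domAltOfRecord F N θ₀.ν K (j + 1), UkExists F N K (j + 1) θ₀.ν.εreg W ∧ UniqueUkOrbit F N K (j + 1) θ₀.ν.εreg W)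
    (hcrit : ∀ W ∈ domAltOfRecord F N θ₀.ν K (j + 1), critCfgOfRecord F N θ₀.ν K j W ∈ domAltOfRecord F N θ₀.ν K j)
    (π : Equiv.Perm (Fin (F.P K).d)) (U : GaugeField (F.P K) j (SU N)) (hU : (avOfRecord F N K j).avg U ∈ domAltOfRecord F N θ₀.ν K (j + 1)) :
    chiβOfRecord₁₃Ax F N θ₀ K g j (U.permute π) = chiβOfRecord₁₃Ax F N θ₀ K g j U :=
  chiFixed29Ax_permute_of_adm θ₀.ε₂₉ (Nat.le_of_succ_le hj) g π U (h11 _ hU).1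
    (h11 _ ((mem_domAltOfRecord_iff F N θ₀.ν K (j + 1) _).2
      ((B12RegularClassInvariance263.plaqSmall_permute_iff θ₀.ν.ε₀ π _).2 ((mem_domAltOfRecord_iff F N θ₀.ν K (j + 1) _).1 hU)))).2
    fun x => adm_stairHol_of_mem_domAlt K θ₀.ν hj hε hnum (hcrit _ hU) (blockOf x) (Finset.mem_filter.2 ⟨Finset.mem_univ _, rfl⟩)

/-! ## §2 `A_k` at the re-centred record is permutation invariant on the small-field domains -/

/-- **`A_k(πU) = A_k(U)` ON `domAlt_k`, all `k ≤ n ≤ K`, AT THE RE-CENTRED RECORD**, from [B11] Thm 1 on the domains (levels `< n`), (F7a), (F7a-supp), (I19), the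
NESTING row «`V^{(j)}(W) ∈ domAlt_j`» (levels `< n`) and the numeric guard. [cite: Balaban1987RG1, p.263, (2.17) p.269, (0.13) p.254, (0.19) p.255, (0.11) p.253; Balaban1985Variational, Thm 1 p.279] -/
theorem invOn_effActionHT_recordAx_permute {n : ℕ} (hn : n ≤ K) (π : Equiv.Perm (Fin (F.P K).d)) (hε : 0 ≤ θ₀.ν.ε₀)
    (hnum : ((((F.P K).d * (F.P K).L : ℕ) : ℝ)) ^ 2 / 4 * θ₀.ν.ε₀ < deltaFed (Fin N))
    (h11 : ∀ j < n, ∀ W ∈ domAltOfRecord F N θ₀.ν K (j + 1), UkExists F N K (j + 1) θ₀.ν.εreg W ∧ UniqueUkOrbit F N K (j + 1) θ₀.ν.εreg W)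
    (hcrit : ∀ j < n, ∀ W ∈ domAltOfRecord F N θ₀.ν K (j + 1), critCfgOfRecord F N θ₀.ν K j W ∈ domAltOfRecord F N θ₀.ν K j)
    (hF7a : ∀ j < n, domAltOfRecord F N θ₀.ν K (j + 1) ⊆
      regSetOfRecord F N K j (betaInputOfRecord F N (TβOfRecord₁₃ F N) (chiβOfRecord₁₃Ax F N θ₀) K g j))
    (hsupp : ∀ j < n, ∀ᵐ U ∂(fieldMeasure (F.P K) j (SU N)), (avOfRecord F N K j).avg U ∈ domAltOfRecord F N θ₀.ν K (j + 1) →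
      U ∉ domAltOfRecord F N θ₀.ν K j → chiβOfRecord₁₃Ax F N θ₀ K g j U = 0)
    (hint : ∀ j < n, Integrable (betaInputOfRecord F N (TβOfRecord₁₃ F N) (chiβOfRecord₁₃Ax F N θ₀) K g j) (fieldMeasure (F.P K) j (SU N))) :
    ∀ k ≤ n, ∀ U, U ∈ domAltOfRecord F N θ₀.ν K k →
      effActionHT F N (TβOfRecord₁₃ F N) (chiβOfRecord₁₃Ax F N θ₀) K g k (U.permute π) =
        effActionHT F N (TβOfRecord₁₃ F N) (chiβOfRecord₁₃Ax F N θ₀) K g k U := by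
  have hn' : n ≤ (F.P K).m + (F.P K).K := hn.trans (by simp only [T4Continuum.T4Family.P_K]; omega)
  have h := invOn_effActionHT_of_stepsOn_family_on F N (TβOfRecord₁₃ F N) (chiβOfRecord₁₃Ax F N θ₀) K g n
    (fun j => domAltOfRecord F N θ₀.ν K j) (fun j => domAltOfRecord F N θ₀.ν K j) (I := fun _ => Equiv.Perm (Fin (F.P K).d)) (fun _ π' => π')
    (fun _ π' U => U.permute π')
    (fun π' U => (wilsonAction_invariant_generators F N (K := K) 1).2.1 π' U) (fun j hj π' => ?_) hsupp (fun j hj π' U hU => ?_)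
    (fun j hj π' hρ V hV => ?_)
  · exact fun k hk U hU => h k hk π U hU
  · have hj' : j + 1 ≤ (F.P K).m + (F.P K).K := (Nat.succ_le_of_lt hj).trans hn'
    exact Filter.Eventually.of_forall fun U hU => chiβOfRecord₁₃Ax_permute_of_mem_domAlt θ₀ K g hj' hε hnum (h11 j hj) (hcrit j hj) π' U hU
  · have hj' : j + 1 ≤ (F.P K).m + (F.P K).K := (Nat.succ_le_of_lt hj).trans hn'
    exact gfOfRecord_permute_of_mem_domAlt K θ₀.ν hj' hε hnum π' U hU
  · exact TcanOfRecord_permute_of_mem_regSet_inter_of_on (lt_of_lt_of_le hj hn) (hint j hj) π' (isOpen_domAltOfRecord θ₀.ν K (j + 1))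
      (fun W => permute_mem_domAltOfRecord_iff K θ₀.ν (j + 1) π' W) hρ ⟨hF7a j hj hV, hV⟩

/-! ## §3 The merged term at the re-centred record is permutation invariant on the domain -/

/-- **★ `𝓝_{k+1}(πW) = 𝓝_{k+1}(W)` AT THE RE-CENTRED RECORD for `W ∈ domAlt_{k+1}`** (`k + 1 ≤ K`): rows — [B11] on the domains (levels `≤ k+1`, radius `ν.εreg`), (F7a) at
levels `≤ k`, (F7a-supp), (I19), the NESTING rows «`Ū^k U_{k+1}(W) ∈ domAlt_k`» (radius `ε`) and «`V^{(j)}(W′) ∈ domAlt_j` for `W′ ∈ domAlt_{j+1}`, `j ≤ k`» (radius `ν.εreg`),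
[B11] at `W`, `πW` (radius `ε`), and the numeric guard `0 ≤ ν.ε₀`, `((d·L)²∕4)·ν.ε₀ < δ_N`; the `A_k`-rows on `domAlt_k` (gauge: FILE `…Sect5GaugeOn` §2 with (F7a);
permutation: §2) are discharged inside. [cite: Balaban1987RG1, (1.6) p.261, (2.17) p.269, p.263, (1.2) p.260, (0.11) p.253; Balaban1985Variational, Thm 1 p.279] -/
theorem mergedTermT_permute_on_recordAx (ε : ℝ) {k : ℕ} (hk : k + 1 ≤ K) (π : Equiv.Perm (Fin (F.P K).d)) (hε : 0 ≤ θ₀.ν.ε₀)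
    (hnum : ((((F.P K).d * (F.P K).L : ℕ) : ℝ)) ^ 2 / 4 * θ₀.ν.ε₀ < deltaFed (Fin N))
    (h11 : ∀ j < k + 1, ∀ W ∈ domAltOfRecord F N θ₀.ν K (j + 1), UkExists F N K (j + 1) θ₀.ν.εreg W ∧ UniqueUkOrbit F N K (j + 1) θ₀.ν.εreg W)
    (hcrit : ∀ j < k + 1, ∀ W ∈ domAltOfRecord F N θ₀.ν K (j + 1), critCfgOfRecord F N θ₀.ν K j W ∈ domAltOfRecord F N θ₀.ν K j)
    (hF7a : ∀ j < k + 1, domAltOfRecord F N θ₀.ν K (j + 1) ⊆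
      regSetOfRecord F N K j (betaInputOfRecord F N (TβOfRecord₁₃ F N) (chiβOfRecord₁₃Ax F N θ₀) K g j))
    (hsupp : ∀ j < k + 1, ∀ᵐ U ∂(fieldMeasure (F.P K) j (SU N)), (avOfRecord F N K j).avg U ∈ domAltOfRecord F N θ₀.ν K (j + 1) →
      U ∉ domAltOfRecord F N θ₀.ν K j → chiβOfRecord₁₃Ax F N θ₀ K g j U = 0)
    (hint : ∀ j < k + 1, Integrable (betaInputOfRecord F N (TβOfRecord₁₃ F N) (chiβOfRecord₁₃Ax F N θ₀) K g j) (fieldMeasure (F.P K) j (SU N)))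
    {W : GaugeField (F.P K) (k + 1) (SU N)} (hWD : W ∈ domAltOfRecord F N θ₀.ν K (k + 1))
    (hnest : Averaging.iter (avOfRecord F N K) k (Uk F N K (k + 1) ε W) ∈ domAltOfRecord F N θ₀.ν K k)
    (hW : UkExists F N K (k + 1) ε W) (hu : UniqueUkOrbit F N K (k + 1) ε (W.permute π)) :
    mergedTermT F N (TβOfRecord₁₃ F N) (chiβOfRecord₁₃Ax F N θ₀) ε K g k (W.permute π) =
      mergedTermT F N (TβOfRecord₁₃ F N) (chiβOfRecord₁₃Ax F N θ₀) ε K g k W := by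
  have hk' : k + 1 ≤ (F.P K).m + (F.P K).K := hk.trans (by simp only [T4Continuum.T4Family.P_K]; omega)
  have hAπ := invOn_effActionHT_recordAx_permute θ₀ K g hk π hε hnum h11 hcrit hF7a hsupp hint
  -- the gauge row of `A_k` on `domAlt_k`: FILE `…Sect5GaugeOn` §2 gives it on `regSet_{k−1} ∩ domAlt_k`, which is `domAlt_k` under (F7a)
  have hAg : ∀ (w : GaugeTransf (F.P K) k (SU N)) (U : GaugeField (F.P K) k (SU N)), U ∈ domAltOfRecord F N θ₀.ν K k →
      effActionHT F N (TβOfRecord₁₃ F N) (chiβOfRecord₁₃Ax F N θ₀) K g k (gaugeAct w U) = effActionHT F N (TβOfRecord₁₃ F N) (chiβOfRecord₁₃Ax F N θ₀) K g k U := by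
    intro w U hU
    have hχreg : ∀ i, i + 1 < k + 1 → ∀ᵐ U ∂(fieldMeasure (F.P K) (i + 1) (SU N)),
        (avOfRecord F N K (i + 1)).avg U ∈ domAltOfRecord F N θ₀.ν K (i + 2) →
          U ∉ regSetOfRecord F N K i (betaInputOfRecord F N (TβOfRecord₁₃ F N) (chiβOfRecord₁₃Ax F N θ₀) K g i) ∩ domAltOfRecord F N θ₀.ν K (i + 1) →
            chiβOfRecord₁₃Ax F N θ₀ K g (i + 1) U = 0 := fun i hi =>
      (hsupp (i + 1) hi).mono fun U h hS hD => h hS fun hU' => hD ⟨hF7a i (by omega) hU', hU'⟩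
    have hA := invOn_effActionHT_recordAx_of_stepsOn θ₀ K g hk h11 hχreg hint k (Nat.le_succ k) w U
    cases k with
    | zero => exact hA (Set.mem_univ _)
    | succ i => exact hA ⟨hF7a i (by omega) hU, hU⟩
  -- the image row at level `k` on `domAlt_{k+1}`: the density `ρ_k` is `π`-invariant a.e. over the fibres of the domain
  have hρ : ∀ᵐ U ∂(fieldMeasure (F.P K) k (SU N)), (avOfRecord F N K k).avg U ∈ domAltOfRecord F N θ₀.ν K (k + 1) →
      betaInputOfRecord F N (TβOfRecord₁₃ F N) (chiβOfRecord₁₃Ax F N θ₀) K g k (U.permute π) =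
        betaInputOfRecord F N (TβOfRecord₁₃ F N) (chiβOfRecord₁₃Ax F N θ₀) K g k U :=
    integrand_comp_ae_eq_on_of_invOn
      (Filter.Eventually.of_forall fun U hU => chiβOfRecord₁₃Ax_permute_of_mem_domAlt θ₀ K g hk' hε hnum (h11 k (Nat.lt_succ_self k))
        (hcrit k (Nat.lt_succ_self k)) π U hU)
      (hsupp k (Nat.lt_succ_self k)) (fun U hU => gfOfRecord_permute_of_mem_domAlt K θ₀.ν hk' hε hnum π U hU)
      (fun U hU => hAπ k (Nat.le_succ k) U hU) (g k)
  have hTon : ∀ V : GaugeField (F.P K) (k + 1) (SU N), V ∈ domAltOfRecord F N θ₀.ν K (k + 1) →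
      TβOfRecord₁₃ F N K k (betaInputOfRecord F N (TβOfRecord₁₃ F N) (chiβOfRecord₁₃Ax F N θ₀) K g k) (V.permute π) =
        TβOfRecord₁₃ F N K k (betaInputOfRecord F N (TβOfRecord₁₃ F N) (chiβOfRecord₁₃Ax F N θ₀) K g k) V := fun V hV =>
    TcanOfRecord_permute_of_mem_regSet_inter_of_on hk (hint k (Nat.lt_succ_self k)) π (isOpen_domAltOfRecord θ₀.ν K (k + 1))
      (fun W => permute_mem_domAltOfRecord_iff K θ₀.ν (k + 1) π W) hρ ⟨hF7a k (Nat.lt_succ_self k) hV, hV⟩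
  exact mergedTermT_permute_on F N (TβOfRecord₁₃ F N) (chiβOfRecord₁₃Ax F N θ₀) ε g hk' π hTon hAg
    (fun U hU => (permute_mem_domAltOfRecord_iff K θ₀.ν k π U).2 hU) (fun U hU => hAπ k (Nat.le_succ k) U hU) hWD hnest hW hu

end Rows

/-! ## §4 (5.6), (5.7), (5.8)₂ for `recordPlimAx` from N09-shape rows only; (1.22) at every pair of distinct directions -/

section Record

open Summit.QuantumFields.YangMills.Theorems.K0RecordFormatNames
open B12PolarizationTensor120 (expChart)

variable (F) (a₀ ε₂₉ : ℝ)

/-- **★★ (5.6), (5.7) AND (5.8)₂ FOR `recordPlimAx F a₀ ε₂₉ k v` FROM N09-SHAPE ROWS**: with `θ := thetaFill F a₀ ε₂₉`, `g := extd v`, if `0 ≤ θ.ν.ε₀`, `0 < θ.ν.ε₀`, the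
limit (1.21) exists, and for all large `K`: the numeric guard `((d·L)²∕4)·θ.ν.ε₀ < δ_N`, the chart is `C²` at `0`, `k + 1 ≤ K`, [B11] on the domains (radius `ν.εreg`, levels
`≤ k+1`), the NESTING row «`V^{(j)}(W) ∈ domAlt_j` on `domAlt_{j+1}`» (levels `≤ k`), (F7a), (F7a-supp), (I19), and for every `W ∈ domAlt_{k+1}` the nesting `Ū^k U_{k+1}(W) ∈
domAlt_k` and [B11] at radius `θ.εbg` — then the record's limiting kernel is index-symmetric, permutation covariant and reflection covariant: the rows `symm ∕ perm ∕ refl` of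
`B12Carve25Sect5TensorHyp.Hyp` AT THE RECORD, every Euclidean hypothesis reduced to displayed N09-shape rows.
[cite: Balaban1987RG1, (5.6)-(5.8) pp.292-293, (5.2)-(5.4) p.292, (2.17)-(2.18) p.269, (1.21) p.264, (0.11) p.253; Balaban1985Variational, Thm 1 p.279] -/
theorem recordPlimAx_symmetries_of_rows (k : ℕ) (v : Fin (k + 1) → ℝ)
    (hε₀ : 0 < (thetaFill F a₀ ε₂₉).ν.ε₀)
    (hlim : letI θ := thetaFill F a₀ ε₂₉
      letI := θ.instVβ₁; letI := θ.instVβ₂; letI := θ.instιβ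
      PolLimitExists F (k + 1) (fun K => recordTermsAx F a₀ ε₂₉ k v K) θ.ρ8 θ.bV)
    (hC2 : letI θ := thetaFill F a₀ ε₂₉
      letI := θ.instVβ₁; letI := θ.instVβ₂
      ∀ᶠ K in atTop, ContDiffAt ℝ 2 (expChart (recordTermsAx F a₀ ε₂₉ k v K) θ.ρ8) 0)
    (hrows : letI θ := thetaFill F a₀ ε₂₉
      ∀ᶠ K in atTop, k + 1 ≤ K ∧ ((((F.P K).d * (F.P K).L : ℕ) : ℝ)) ^ 2 / 4 * θ.ν.ε₀ < deltaFed (Fin 2) ∧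
        (∀ j < k + 1, ∀ W ∈ domAltOfRecord F 2 θ.ν K (j + 1), UkExists F 2 K (j + 1) θ.ν.εreg W ∧ UniqueUkOrbit F 2 K (j + 1) θ.ν.εreg W) ∧
        (∀ j < k + 1, ∀ W ∈ domAltOfRecord F 2 θ.ν K (j + 1), critCfgOfRecord F 2 θ.ν K j W ∈ domAltOfRecord F 2 θ.ν K j) ∧
        (∀ j < k + 1, domAltOfRecord F 2 θ.ν K (j + 1) ⊆
          regSetOfRecord F 2 K j (betaInputOfRecord F 2 (TβOfRecord₁₃ F 2) (chiβOfRecord₁₃Ax F 2 θ) K (T4FlagMemory.extd v) j)) ∧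
        (∀ j < k + 1, ∀ᵐ U ∂(fieldMeasure (F.P K) j (SU 2)), (avOfRecord F 2 K j).avg U ∈ domAltOfRecord F 2 θ.ν K (j + 1) →
          U ∉ domAltOfRecord F 2 θ.ν K j → chiβOfRecord₁₃Ax F 2 θ K (T4FlagMemory.extd v) j U = 0) ∧
        (∀ j < k + 1, Integrable (betaInputOfRecord F 2 (TβOfRecord₁₃ F 2) (chiβOfRecord₁₃Ax F 2 θ) K (T4FlagMemory.extd v) j) (fieldMeasure (F.P K) j (SU 2))) ∧
        (∀ W ∈ domAltOfRecord F 2 θ.ν K (k + 1),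
          Averaging.iter (avOfRecord F 2 K) k (Uk F 2 K (k + 1) θ.εbg W) ∈ domAltOfRecord F 2 θ.ν K k ∧
            UkExists F 2 K (k + 1) θ.εbg W ∧ UniqueUkOrbit F 2 K (k + 1) θ.εbg W)) :
    Beta.PolarizationSign.IndexSymmetric (recordPlimAx F a₀ ε₂₉ k v) ∧ B12Beta.PermCovariant (recordPlimAx F a₀ ε₂₉ k v) ∧
      B12Transverse536.ReflCovariant (recordPlimAx F a₀ ε₂₉ k v) := by
  letI θ := thetaFill F a₀ ε₂₉; letI := θ.instVβ₁; letI := θ.instVβ₂; letI := θ.instιβ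
  refine recordPlimAx_symmetries_of_local a₀ ε₂₉ k v hlim hC2 ?_
  filter_upwards [hrows] with K hK
  obtain ⟨hk, hnum, h11, hcrit, hF7a, hsupp, hint, htop⟩ := hK
  refine ⟨θ.ν.ε₀, hε₀, fun W hW => ?_⟩
  have hWD : W ∈ domAltOfRecord F 2 θ.ν K (k + 1) := (mem_domAltOfRecord_iff F 2 θ.ν K (k + 1) W).2 hW
  refine ⟨fun a => ?_, fun π => ?_, fun ρ' => ?_⟩
  · have hWa : W.translate a ∈ domAltOfRecord F 2 θ.ν K (k + 1) := (translate_mem_domAltOfRecord_iff K θ.ν (k + 1) a W).2 hWD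
    exact mergedTermT_translate_on_recordAx θ K (T4FlagMemory.extd v) θ.εbg hk a h11 hF7a hsupp hint hWD (htop W hWD).1 (htop W hWD).2.1 (htop _ hWa).2.2
  · have hWπ : W.permute π ∈ domAltOfRecord F 2 θ.ν K (k + 1) := (permute_mem_domAltOfRecord_iff K θ.ν (k + 1) π W).2 hWD
    exact mergedTermT_permute_on_recordAx θ K (T4FlagMemory.extd v) θ.εbg hk π hε₀.le hnum h11 hcrit hF7a hsupp hint hWD (htop W hWD).1 (htop W hWD).2.1
      (htop _ hWπ).2.2
  · have hWr : W.creflect ρ' ∈ domAltOfRecord F 2 θ.ν K (k + 1) := (creflect_mem_domAltOfRecord_iff K θ.ν (k + 1) ρ' W).2 hWD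
    exact mergedTermT_creflect_on_recordAx θ K (T4FlagMemory.extd v) θ.εbg hk ρ' h11 hF7a hsupp hint hWD (htop W hWD).1 (htop W hWD).2.1 (htop _ hWr).2.2

/-- **★ (1.22) «FOR μ, ν ARBITRARY, μ ≠ ν» AT THE RE-CENTRED RECORD FROM ROWS**: on the β-box `v ∈ Box ½ k`, under the rows of `recordPlimAx_symmetries_of_rows`, the
coefficient `β_{k+1}(v) = betaOfRecord₁₃Ax F 2 θ k v` is the second moment of the record's limiting kernel at EVERY pair of distinct directions.
[cite: Balaban1987RG1, (1.22) p.264, (5.6) p.292, (5.42) p.297] -/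
theorem betaOfRecord₁₃Ax_eq_secondMoment_of_rows {k : ℕ} {v : Fin (k + 1) → ℝ} (hv : v ∈ FlowStep.Box (1 / 2) k)
    (hε₀ : 0 < (thetaFill F a₀ ε₂₉).ν.ε₀)
    (hlim : letI θ := thetaFill F a₀ ε₂₉
      letI := θ.instVβ₁; letI := θ.instVβ₂; letI := θ.instιβ
      PolLimitExists F (k + 1) (fun K => recordTermsAx F a₀ ε₂₉ k v K) θ.ρ8 θ.bV)
    (hC2 : letI θ := thetaFill F a₀ ε₂₉
      letI := θ.instVβ₁; letI := θ.instVβ₂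
      ∀ᶠ K in atTop, ContDiffAt ℝ 2 (expChart (recordTermsAx F a₀ ε₂₉ k v K) θ.ρ8) 0)
    (hrows : letI θ := thetaFill F a₀ ε₂₉
      ∀ᶠ K in atTop, k + 1 ≤ K ∧ ((((F.P K).d * (F.P K).L : ℕ) : ℝ)) ^ 2 / 4 * θ.ν.ε₀ < deltaFed (Fin 2) ∧
        (∀ j < k + 1, ∀ W ∈ domAltOfRecord F 2 θ.ν K (j + 1), UkExists F 2 K (j + 1) θ.ν.εreg W ∧ UniqueUkOrbit F 2 K (j + 1) θ.ν.εreg W) ∧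
        (∀ j < k + 1, ∀ W ∈ domAltOfRecord F 2 θ.ν K (j + 1), critCfgOfRecord F 2 θ.ν K j W ∈ domAltOfRecord F 2 θ.ν K j) ∧
        (∀ j < k + 1, domAltOfRecord F 2 θ.ν K (j + 1) ⊆
          regSetOfRecord F 2 K j (betaInputOfRecord F 2 (TβOfRecord₁₃ F 2) (chiβOfRecord₁₃Ax F 2 θ) K (T4FlagMemory.extd v) j)) ∧
        (∀ j < k + 1, ∀ᵐ U ∂(fieldMeasure (F.P K) j (SU 2)), (avOfRecord F 2 K j).avg U ∈ domAltOfRecord F 2 θ.ν K (j + 1) →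
          U ∉ domAltOfRecord F 2 θ.ν K j → chiβOfRecord₁₃Ax F 2 θ K (T4FlagMemory.extd v) j U = 0) ∧
        (∀ j < k + 1, Integrable (betaInputOfRecord F 2 (TβOfRecord₁₃ F 2) (chiβOfRecord₁₃Ax F 2 θ) K (T4FlagMemory.extd v) j) (fieldMeasure (F.P K) j (SU 2))) ∧
        (∀ W ∈ domAltOfRecord F 2 θ.ν K (k + 1),
          Averaging.iter (avOfRecord F 2 K) k (Uk F 2 K (k + 1) θ.εbg W) ∈ domAltOfRecord F 2 θ.ν K k ∧
            UkExists F 2 K (k + 1) θ.εbg W ∧ UniqueUkOrbit F 2 K (k + 1) θ.εbg W))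
    {μ ν : Fin 4} (hμν : μ ≠ ν) :
    betaOfRecord₁₃Ax F 2 (thetaFill F a₀ ε₂₉) k v = B12Beta.secondMoment (recordPlimAx F a₀ ε₂₉ k v) μ ν :=
  betaOfRecord₁₃Ax_eq_secondMoment_of_permCovariant a₀ ε₂₉ hv (recordPlimAx_symmetries_of_rows F a₀ ε₂₉ k v hε₀ hlim hC2 hrows).2.1 hμν

end Record

end Summit.QuantumFields.YangMills.Theorems.BalabanUVNodesPortS1

end
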